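import Summits.BirchSwinnertonDyer.BirchSwinnertonDyer.Theorems.ClassRecordThreeRegCertKernelO3Cert
import Summits.BirchSwinnertonDyer.BirchSwinnertonDyer.Theorems.ClassRecordThreeRegCertKernelDeep
import HarnessLib

/-!
# Route `ClassRecordThree`, crux `SchneiderAtThree` (item 19106): series estimates for the PRECISION-PARAMETRISED deep
# REG3CERT kernel checker — quartic `log_Ŵ`, cubic `ch`, and `C²` to `3⁻ᵐ` from the curve's own `3^δ ∣ Δ`
# (cell `bsd-stepL`, seat `bsd-stepL-reg3-eng` g4; `--supports stmt-BirchSwinnertonDyer-19106`)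

HONEST FRAMING: BSD is not proved by any of this; nothing here closes the crux; Schneider's non-degeneracy conjecture
(barrier `PAdicHeightNondegeneracy`) is asserted NOWHERE; every application is ONE curve. Companion of the fixed-modulus
checkers `…RegCertKernel{Deep,O2Deep,O3Deep,O3Mid,O4Deep,O4Mid}` (seat g3), whose residue chains hard-wire every modulus
for the worst case `v₃(Δ) = 1`. The remaining non-huge REG3CERT rows (`v₃(h) ∈ {4, 5, 7}`) have LARGE `δ = v₃(Δ(W))`, so
FIRST-order Tate-curve expansions already give the uniformisation scale `C²` to `3^{2δ+1}`; this file provides the three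
series estimates of the uniform checker (`…RegCertKernelUniform`) with every modulus a PARAMETER:

* §1 `‖log_Ŵ(z) − (z + a₁z²/2 + (a₁²+a₂)z³/3 + (a₁³+2a₁a₂+2a₃)z⁴/4)‖ ≤ ‖z‖⁵` on `‖z‖ ≤ 3⁻²` (quartic, deep);
* §2 `‖ch(w) − 1 − w/2 − w²/24 − w³/720‖ ≤ 9‖w‖⁴` on `‖w‖ ≤ 3⁻⁴`;
* §3 `‖C² − Γ‖ ≤ 3⁻ᵐ` from `3^m ∣ (c₄³ − 504Δ)c₄ + Γc₆(c₄³ + 240Δ)`, `m ≤ 2δ + 1`, for any `q` with `‖q‖ ≤ 3^{−δ}`,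
  `‖q − Δ/c₄³‖ ≤ 3^{−2δ}` (THE Tate parameter: tree `norm_inv_tateJ_sub_le`).

Theorems only (0 defs, 0 facts). References: [SteinWuthrich2013] §4.2; [SilvermanAEC2009] IV.5–IV.6;
[SilvermanATAEC1994] V.3, V.5.1.
-/

open scoped Classical

open PowerSeries WeierstrassCurve Literature.NumberTheory.EllipticCurves
  Literature.NumberTheory.EllipticCurves.Rank1Residual
  Literature.NumberTheory.EllipticCurves.SteinWuthrich2013
  Summit.BirchSwinnertonDyer.Rank1Residual
  Summit.BirchSwinnertonDyer.Rank1Residual.X11b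
  Summit.BirchSwinnertonDyer.Rank1Residual.X11b.RegMult.Rung62310y1

namespace Summit.BirchSwinnertonDyer.Rank1Residual.X11b.RegMult.KernelCert

/-! ### §0 Plumbing -/

/-- `1/3^l ≤ 1/3^k` for `k ≤ l`. [folklore] -/
private theorem third_pow_le {k l : ℕ} (h : k ≤ l) : 1 / (3 : ℝ) ^ l ≤ 1 / (3 : ℝ) ^ k :=
  one_div_le_one_div_of_le (by positivity) (pow_le_pow_right₀ (by norm_num) h)

/-- `‖(2 : ℚ₃)⁻¹‖ = 1`. [folklore] -/
private theorem norm_inv_two₇ : ‖(2 : ℚ_[3])⁻¹‖ = 1 := by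
  rw [norm_inv, show (2 : ℚ_[3]) = ((2 : ℤ) : ℚ_[3]) by norm_cast, norm_intCast_eq_one_of_not_dvd (by decide),
    inv_one]

/-- `‖(n : ℚ₃)⁻¹‖ = 1` for an integer `n` prime to `3`. [folklore] -/
private theorem norm_inv_intCast_eq_one {n : ℤ} (h : ¬ (3 : ℤ) ∣ n) : ‖((n : ℚ_[3]))⁻¹‖ = 1 := by
  rw [norm_inv, norm_intCast_eq_one_of_not_dvd h, inv_one]

/-- `n + 7 ≤ 3^{n+2}`. [folklore] -/
private theorem add_seven_le_three_pow' (n : ℕ) : n + 7 ≤ 3 ^ (n + 2) := by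
  induction n with
  | zero => norm_num
  | succ k ih =>
    have h : 3 ^ (k + 1 + 2) = 3 * 3 ^ (k + 2) := by ring
    omega

/-- `‖1/(n+5)‖₃ ≤ 3ⁿ`. [folklore] -/
private theorem norm_inv_natCast_add_five_le' (n : ℕ) : ‖(((n + 5 : ℕ) : ℚ_[3]))⁻¹‖ ≤ (3 : ℝ) ^ n := by
  rcases Nat.lt_or_ge n 2 with hn | hn
  · interval_cases n
    · rw [show ((0 + 5 : ℕ) : ℚ_[3]) = ((5 : ℤ) : ℚ_[3]) by norm_num, norm_inv_intCast_eq_one (by decide)]; norm_num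
    · have h2 : ‖(2 : ℚ_[3])⁻¹‖ = 1 := norm_inv_two₇
      have h3 : ‖(3 : ℚ_[3])⁻¹‖ = 3 := by
        rw [norm_inv, show (3 : ℚ_[3]) = ((3 : ℕ) : ℚ_[3]) by norm_cast, Padic.norm_p]; norm_num
      rw [show ((1 + 5 : ℕ) : ℚ_[3]) = 2 * 3 by norm_num, mul_inv, norm_mul, h2, h3]; norm_num
  · have hm : ‖(((n + 5 : ℕ) : ℚ_[3]))⁻¹‖ ≤ ((n + 5 : ℕ) : ℝ) := padic_norm_inv_natCast_le _
    have hpow : ((n + 5 : ℕ) : ℝ) ≤ (3 : ℝ) ^ n := by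
      obtain ⟨k, rfl⟩ : ∃ k, n = k + 2 := ⟨n - 2, by omega⟩
      have := add_seven_le_three_pow' k
      rw [show k + 2 + 5 = k + 7 by ring]; exact_mod_cast this
    exact hm.trans hpow

/-- **Legendre at `p = 3`**: `‖1/(2n)!‖₃ ≤ 3ⁿ`. [cite: SilvermanAEC2009, IV.6.3] -/
private theorem norm_inv_factorial_le₇ (n : ℕ) : ‖(((2 * n).factorial : ℕ) : ℚ_[3])⁻¹‖ ≤ (3 : ℝ) ^ n := by
  have hf : ((2 * n).factorial : ℕ) ≠ 0 := Nat.factorial_ne_zero _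
  rw [norm_inv, Padic.norm_eq_zpow_neg_valuation (by exact_mod_cast hf), Padic.valuation_natCast, zpow_neg,
    inv_inv, zpow_natCast]
  have hv : padicValNat 3 (2 * n).factorial ≤ n := by
    have h := sub_one_mul_padicValNat_factorial (p := 3) (2 * n)
    have hs : (3 - 1) * padicValNat 3 (2 * n).factorial ≤ 2 * n := by rw [h]; exact Nat.sub_le _ _
    omega
  exact_mod_cast Nat.pow_le_pow_right (by norm_num) hv

/-! ### §1 The formal logarithm to fourth order at a deep point: error `‖z‖⁵` on `‖z‖ ≤ 3⁻²` -/

section Padic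

variable (V : WeierstrassCurve ℚ_[3]) [V.IsIntegral ℤ_[3]]

/-- The terms of degree `n + 5` of `log_Ŵ(z)` have norm `≤ ‖z‖⁵` when `‖z‖₃ ≤ 3⁻²` (`‖1/(n+5)‖ ≤ 3ⁿ`, `‖z‖ⁿ ≤ 9⁻ⁿ`).
[cite: SilvermanAEC2009, IV.6.3] -/
private theorem norm_formalLog_term_le_five {z : ℚ_[3]} (hz : ‖z‖ ≤ 1 / 9) (n : ℕ) :
    ‖coeff (n + 5) V.formalLog * z ^ (n + 5)‖ ≤ ‖z‖ ^ 5 := by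
  rw [norm_mul, norm_pow]
  have hc := norm_coeff_formalLog_le_norm_inv V (n + 3)
  rw [show n + 3 + 2 = n + 5 by ring] at hc
  have hz0 : 0 ≤ ‖z‖ := norm_nonneg z
  calc ‖coeff (n + 5) V.formalLog‖ * ‖z‖ ^ (n + 5) ≤ (3 : ℝ) ^ n * ‖z‖ ^ (n + 5) := by
        gcongr; exact hc.trans (norm_inv_natCast_add_five_le' n)
    _ = ((3 : ℝ) ^ n * ‖z‖ ^ n) * ‖z‖ ^ 5 := by ring
    _ ≤ ((3 : ℝ) ^ n * (1 / 9 : ℝ) ^ n) * ‖z‖ ^ 5 := by gcongr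
    _ ≤ 1 * ‖z‖ ^ 5 := by
        gcongr
        rw [← mul_pow]; exact pow_le_one₀ (by norm_num) (by norm_num)
    _ = ‖z‖ ^ 5 := one_mul _

/-- **`log_Ŵ(z) = z + (a₁/2)z² + ((a₁²+a₂)/3)z³ + ((a₁³+2a₁a₂+2a₃)/4)z⁴ + O(‖z‖⁵)` on `‖z‖₃ ≤ 3⁻²`** for a
`3`-integral equation over `ℚ₃` (the deep form of `norm_padicFormalLog_sub_quartic_le`). [cite: SilvermanAEC2009, IV.5.5, IV.6.4] -/
theorem norm_padicFormalLog_sub_quartic_le_deep {z : ℚ_[3]} (hz : ‖z‖ ≤ 1 / 9) :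
    ‖V.padicFormalLog z - (z + (2 : ℚ_[3])⁻¹ * V.a₁ * z ^ 2 + (3 : ℚ_[3])⁻¹ * (V.a₁ ^ 2 + V.a₂) * z ^ 3 +
      (4 : ℚ_[3])⁻¹ * (V.a₁ ^ 3 + 2 * V.a₁ * V.a₂ + 2 * V.a₃) * z ^ 4)‖ ≤ ‖z‖ ^ 5 := by
  have hs := V.summable_formalLog_of_isIntegral z (hz.trans_lt (by norm_num))
  have hsplit := hs.sum_add_tsum_nat_add 5
  have h0 : coeff 0 V.formalLog = 0 := by rw [coeff_zero_eq_constantCoeff]; exact V.constantCoeff_formalLog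
  have h2 : coeff 2 V.formalLog = (2 : ℚ_[3])⁻¹ * V.a₁ := by
    rw [(coeff_two_formalLog V), eq_ratCast]; push_cast; ring
  have h3 : coeff 3 V.formalLog = (3 : ℚ_[3])⁻¹ * (V.a₁ ^ 2 + V.a₂) := by
    rw [(coeff_three_formalLog V), eq_ratCast]; push_cast; ring
  have h4 : coeff 4 V.formalLog = (4 : ℚ_[3])⁻¹ * (V.a₁ ^ 3 + 2 * V.a₁ * V.a₂ + 2 * V.a₃) := by
    rw [(coeff_four_formalLog V), eq_ratCast]; push_cast; ring
  have hfive : ∑ i ∈ Finset.range 5, coeff i V.formalLog * z ^ i =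
      z + (2 : ℚ_[3])⁻¹ * V.a₁ * z ^ 2 + (3 : ℚ_[3])⁻¹ * (V.a₁ ^ 2 + V.a₂) * z ^ 3 +
        (4 : ℚ_[3])⁻¹ * (V.a₁ ^ 3 + 2 * V.a₁ * V.a₂ + 2 * V.a₃) * z ^ 4 := by
    simp only [Finset.sum_range_succ, Finset.sum_range_zero, h0, V.coeff_one_formalLog, h2, h3, h4]
    ring
  rw [WeierstrassCurve.padicFormalLog, ← hsplit, hfive, add_sub_cancel_left]
  exact IsUltrametricDist.norm_tsum_le_of_forall_le_of_nonneg (by positivity) fun n ↦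
    norm_formalLog_term_le_five V hz n

end Padic

/-! ### §2 The `cosh` series to third order: `‖ch(w) − 1 − w/2 − w²/24 − w³/720‖ ≤ 9‖w‖⁴` on `‖w‖ ≤ 3⁻⁴` -/

/-- **`‖ch(w) − 1 − w/2 − w²/24 − w³/720‖₃ ≤ 9‖w‖⁴` for `‖w‖₃ ≤ 3⁻⁴`**: the quartic term has norm `‖w‖⁴·‖1/8!‖ = 9‖w‖⁴`
and every later term `‖wⁿ/(2n)!‖ ≤ 3ⁿ‖w‖ⁿ ≤ 9‖w‖⁴` (Legendre). [folklore] -/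
theorem norm_coshOfSq_sub_cubic_le_deep {w : ℚ_[3]} (hw : ‖w‖ ≤ 1 / 81) :
    ‖coshOfSq w - 1 - w / 2 - w ^ 2 / 24 - w ^ 3 / 720‖ ≤ 9 * ‖w‖ ^ 4 := by
  have hw9 : ‖w‖ ≤ 1 / 9 := hw.trans (by norm_num)
  have hs := summable_coshOfSq_term hw9
  have hsplit := hs.sum_add_tsum_nat_add 4
  have hdef : coshOfSq w = ∑' n : ℕ, w ^ n / (((2 * n).factorial : ℕ) : ℚ_[3]) := by rw [coshOfSq]
  have hfour : ∑ i ∈ Finset.range 4, w ^ i / (((2 * i).factorial : ℕ) : ℚ_[3]) = 1 + w / 2 + w ^ 2 / 24 + w ^ 3 / 720 := by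
    simp only [Finset.sum_range_succ, Finset.sum_range_zero]
    norm_num [Nat.factorial]
  rw [hdef, ← hsplit, hfour]
  have hring : 1 + w / 2 + w ^ 2 / 24 + w ^ 3 / 720 +
      ∑' n : ℕ, w ^ (n + 4) / (((2 * (n + 4)).factorial : ℕ) : ℚ_[3]) - 1 - w / 2 - w ^ 2 / 24 - w ^ 3 / 720 =
      ∑' n : ℕ, w ^ (n + 4) / (((2 * (n + 4)).factorial : ℕ) : ℚ_[3]) := by ring
  rw [hring]
  refine IsUltrametricDist.norm_tsum_le_of_forall_le_of_nonneg (by positivity) fun n ↦ ?_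
  rw [div_eq_mul_inv, norm_mul, norm_pow]
  cases n with
  | zero =>
    have hf : (2 * (0 + 4)).factorial = 40320 := by decide
    have h9 : ‖(9 : ℚ_[3])⁻¹‖ = 9 := by
      have h3 : ‖(3 : ℚ_[3])⁻¹‖ = 3 := by
        rw [norm_inv, show (3 : ℚ_[3]) = ((3 : ℕ) : ℚ_[3]) by norm_cast, Padic.norm_p]; norm_num
      rw [show (9 : ℚ_[3]) = 3 * 3 by norm_num, mul_inv, norm_mul, h3]; norm_num
    have h40320 : ‖(((40320 : ℕ) : ℚ_[3]))⁻¹‖ = 9 := by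
      rw [show ((40320 : ℕ) : ℚ_[3]) = ((4480 : ℤ) : ℚ_[3]) * 9 by norm_num, mul_inv, norm_mul,
        norm_inv_intCast_eq_one (by decide), h9, one_mul]
    rw [hf, h40320, zero_add, mul_comm]
  | succ k =>
    have hfac := norm_inv_factorial_le₇ (k + 1 + 4)
    calc ‖w‖ ^ (k + 1 + 4) * ‖((((2 * (k + 1 + 4)).factorial : ℕ) : ℚ_[3]))⁻¹‖
        ≤ ‖w‖ ^ (k + 1 + 4) * (3 : ℝ) ^ (k + 1 + 4) := by gcongr
      _ = (9 * ‖w‖ ^ 4) * ((3 * ‖w‖) ^ k * (27 * ‖w‖)) := by ring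
      _ ≤ (9 * ‖w‖ ^ 4) * ((3 * (1 / 81)) ^ k * (27 * (1 / 81))) := by gcongr
      _ ≤ (9 * ‖w‖ ^ 4) * 1 := by
          gcongr
          calc (3 * (1 / 81) : ℝ) ^ k * (27 * (1 / 81)) ≤ 1 ^ k * (27 * (1 / 81)) := by gcongr; norm_num
            _ ≤ 1 := by norm_num
      _ = 9 * ‖w‖ ^ 4 := mul_one _

/-! ### §3 The uniformisation scale to precision `3⁻ᵐ`, `m ≤ 2δ + 1`, from the curve's own `3^δ ∣ Δ` -/

/-- **`C² ≡ −(c₄³ − 504Δ)c₄ / (c₆(c₄³ + 240Δ)) (mod 3ᵐ)` for `m ≤ 2δ + 1`, `3^δ ∣ Δ`.** For any `W/ℚ` with `c₄, c₆` `3`-adic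
units (read in `ℚ₃`), an integer `Δ` with `3^δ ∣ Δ`, an integer `Γ` with `3^m ∣ (c₄³ − 504Δ)c₄ + Γc₆(c₄³ + 240Δ)`, and any
`q ∈ ℚ₃` with `‖q‖ ≤ 3^{−δ}` and `‖q − Δ/c₄³‖ ≤ 3^{−2δ}` (THE Tate parameter when `1/j(W) = Δ/c₄³`):
`‖uniformisationScaleSq W 3 q − Γ‖ ≤ 3⁻ᵐ`. Here `C² = −(1 − 504 s₅(q))c₄/((1 + 240 s₃(q))c₆)` with `s_k(q) ≡ q ≡ Δ/c₄³
(mod 3^{2δ})`. [cite: SteinWuthrich2013, §4.2] [cite: SilvermanATAEC1994, Thm. V.3.1 and Lemma V.5.1] -/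
theorem norm_uniformisationScaleSq_sub_le_of_disc (W : WeierstrassCurve ℚ) {c4 c6 D Γ : ℤ} {m δ : ℕ}
    (hc4 : (W.baseChange ℚ_[3]).c₄ = c4) (hc6 : (W.baseChange ℚ_[3]).c₆ = c6) (h3c4 : ¬ (3 : ℤ) ∣ c4)
    (h3c6 : ¬ (3 : ℤ) ∣ c6) (hδ1 : 1 ≤ δ) (hm : m ≤ 2 * δ + 1)
    (hΓ : (3 : ℤ) ^ m ∣ (c4 ^ 3 - 504 * D) * c4 + Γ * c6 * (c4 ^ 3 + 240 * D))
    {q : ℚ_[3]} (hq : ‖q‖ ≤ 1 / (3 : ℝ) ^ δ) (hqD : ‖q - (D : ℚ_[3]) / (c4 : ℚ_[3]) ^ 3‖ ≤ 1 / (3 : ℝ) ^ (2 * δ)) :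
    ‖uniformisationScaleSq W 3 q - Γ‖ ≤ 1 / (3 : ℝ) ^ m := by
  have hc4n : ‖(c4 : ℚ_[3])‖ = 1 := norm_intCast_eq_one_of_not_dvd h3c4
  have hc6n : ‖(c6 : ℚ_[3])‖ = 1 := norm_intCast_eq_one_of_not_dvd h3c6
  have hJn : ‖(c4 : ℚ_[3]) ^ 3‖ = 1 := by rw [norm_pow, hc4n, one_pow]
  have hJ0 : (c4 : ℚ_[3]) ^ 3 ≠ 0 := by intro h; rw [h, norm_zero] at hJn; exact zero_ne_one hJn
  have hc40 : (c4 : ℚ_[3]) ≠ 0 := by intro h; rw [h, norm_zero] at hc4n; exact zero_ne_one hc4n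
  have hδ3 : 1 / (3 : ℝ) ^ δ ≤ 1 / 3 := by
    calc 1 / (3 : ℝ) ^ δ ≤ 1 / (3 : ℝ) ^ 1 := third_pow_le hδ1
      _ = 1 / 3 := by norm_num
  have hqn : ‖q‖ ≤ 1 / 3 := hq.trans hδ3
  have hq1 : ‖q‖ < 1 := hqn.trans_lt (by norm_num)
  set q0 : ℚ_[3] := (D : ℚ_[3]) / (c4 : ℚ_[3]) ^ 3 with hq0
  have hq2 : ‖q‖ ^ 2 ≤ 1 / (3 : ℝ) ^ (2 * δ) := by
    calc ‖q‖ ^ 2 ≤ (1 / (3 : ℝ) ^ δ) ^ 2 := by gcongr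
      _ = 1 / (3 : ℝ) ^ (2 * δ) := by rw [div_pow, one_pow, ← pow_mul, mul_comm]
  have hs3 : ‖tateS 3 q - q0‖ ≤ 1 / (3 : ℝ) ^ (2 * δ) := by
    have : tateS 3 q - q0 = (tateS 3 q - q) + (q - q0) := by ring
    rw [this]
    exact (IsUltrametricDist.norm_add_le_max _ _).trans
      (max_le ((norm_tateS_sub_self_le 3 hq1).trans hq2) hqD)
  have hs5 : ‖tateS 5 q - q0‖ ≤ 1 / (3 : ℝ) ^ (2 * δ) := by
    have : tateS 5 q - q0 = (tateS 5 q - q) + (q - q0) := by ring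
    rw [this]
    exact (IsUltrametricDist.norm_add_le_max _ _).trans
      (max_le ((norm_tateS_sub_self_le 5 hq1).trans hq2) hqD)
  have hs3n : ‖tateS 3 q‖ ≤ 1 / 3 := (TateCurve.norm_tateS_le hq1.le).trans hqn
  have h12 : (12 : ℚ_[3]) ≠ 0 := by norm_num
  rw [uniformisationScaleSq, TateCurve.tateCurve_c₄, TateCurve.tateCurve_c₆ h12, hc4, hc6, TateCurve.tateE4_eq,
    TateCurve.tateE6]
  set s3 := tateS 3 q
  set s5 := tateS 5 q
  have hΓn : ‖(Γ : ℚ_[3])‖ ≤ 1 := Padic.norm_int_le_one _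
  have h240 : ‖(240 : ℚ_[3])‖ ≤ 1 / 3 := by
    rw [show (240 : ℚ_[3]) = ((240 : ℤ) : ℚ_[3]) by norm_cast]
    exact (norm_intCast_le_of_pow_dvd (k := 1) (by norm_num)).trans (by norm_num)
  have h504 : ‖(504 : ℚ_[3])‖ ≤ 1 / 9 := by
    rw [show (504 : ℚ_[3]) = ((504 : ℤ) : ℚ_[3]) by norm_cast]
    exact (norm_intCast_le_of_pow_dvd (k := 2) (by norm_num)).trans (by norm_num)
  have hDen : ‖(1 + 240 * s3) * (c6 : ℚ_[3])‖ = 1 := by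
    have hsub : ‖(1 + 240 * s3) * (c6 : ℚ_[3]) - c6‖ < ‖(c6 : ℚ_[3])‖ := by
      rw [hc6n, show (1 + 240 * s3) * (c6 : ℚ_[3]) - c6 = 240 * s3 * c6 by ring, norm_mul, norm_mul, hc6n]
      calc ‖(240 : ℚ_[3])‖ * ‖s3‖ * 1 ≤ 1 / 3 * (1 / 3) * 1 := by gcongr
        _ < 1 := by norm_num
    rw [Padic.norm_eq_of_norm_sub_lt_right hsub, hc6n]
  have hDen0 : (1 + 240 * s3) * (c6 : ℚ_[3]) ≠ 0 := by
    intro h; rw [h, norm_zero] at hDen; exact zero_ne_one hDen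
  rw [div_sub' hDen0, norm_div, hDen, div_one]
  have hnum : -(1 - 504 * s5) * (c4 : ℚ_[3]) - (1 + 240 * s3) * (c6 : ℚ_[3]) * (Γ : ℚ_[3]) =
      -(((((c4 ^ 3 - 504 * D) * c4 + Γ * c6 * (c4 ^ 3 + 240 * D) : ℤ)) : ℚ_[3]) / (c4 : ℚ_[3]) ^ 3) +
        -(240 * (Γ : ℚ_[3]) * (c6 : ℚ_[3]) * (s3 - q0)) + 504 * (c4 : ℚ_[3]) * (s5 - q0) := by
    rw [hq0]; push_cast; field_simp; ring
  rw [hnum]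
  have htail : 1 / (3 : ℝ) ^ (2 * δ + 1) ≤ 1 / (3 : ℝ) ^ m := third_pow_le hm
  have h1 : ‖-(((((c4 ^ 3 - 504 * D) * c4 + Γ * c6 * (c4 ^ 3 + 240 * D) : ℤ)) : ℚ_[3]) / (c4 : ℚ_[3]) ^ 3)‖ ≤
      1 / (3 : ℝ) ^ m := by
    rw [norm_neg, norm_div, hJn, div_one]; exact norm_intCast_le_of_pow_dvd hΓ
  have h2 : ‖-(240 * (Γ : ℚ_[3]) * (c6 : ℚ_[3]) * (s3 - q0))‖ ≤ 1 / (3 : ℝ) ^ m := by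
    rw [norm_neg, norm_mul, norm_mul, norm_mul, hc6n]
    calc ‖(240 : ℚ_[3])‖ * ‖(Γ : ℚ_[3])‖ * 1 * ‖s3 - q0‖ ≤ 1 / 3 * 1 * 1 * (1 / (3 : ℝ) ^ (2 * δ)) := by gcongr
      _ = 1 / (3 : ℝ) ^ (2 * δ + 1) := by rw [pow_succ]; field_simp
      _ ≤ 1 / (3 : ℝ) ^ m := htail
  have h3 : ‖504 * (c4 : ℚ_[3]) * (s5 - q0)‖ ≤ 1 / (3 : ℝ) ^ m := by
    rw [norm_mul, norm_mul, hc4n]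
    calc ‖(504 : ℚ_[3])‖ * 1 * ‖s5 - q0‖ ≤ 1 / 9 * 1 * (1 / (3 : ℝ) ^ (2 * δ)) := by gcongr
      _ ≤ 1 / 3 * 1 * (1 / (3 : ℝ) ^ (2 * δ)) := by gcongr; norm_num
      _ = 1 / (3 : ℝ) ^ (2 * δ + 1) := by rw [pow_succ]; field_simp
      _ ≤ 1 / (3 : ℝ) ^ m := htail
  refine (IsUltrametricDist.norm_add_le_max _ _).trans (max_le ?_ h3)
  exact (IsUltrametricDist.norm_add_le_max _ _).trans (max_le h1 h2)

end Summit.BirchSwinnertonDyer.Rank1Residual.X11b.RegMult.KernelCert
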